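import Summits.QuantumFields.BalabanUV.Beta.CompositeCorrectorLocality
import Summits.QuantumFields.BalabanUV.Beta.AxialDressingRootedBmKernel

/-!
# `BalabanUV.Beta.CompositeCorrectorKernel` — binder row D1, work item K-U3d leaf L2: **THE (a1*)_m CORRECTORS KERNELISED** — `Ψ̂ = psiK r L m`,
# `Φ̂ = phiK r L m : MKer (d+1) (Fib d)` (field block `(Ψ_m e_{(β,y)})_α(x)`, multiplier block the identity, NO window cut-off), THE FINITE EXPANSION
# `(Ψ_m A)_α(x) = Σ_{(β,y)} Ψ̂_{(x,α),(y,β)} A_β(y)`, ROW-FINITENESS, FINITE RANGE `0` IN BLOCK UNITS, and THE APPLY BRIDGE `comp Ψ̂ K = Ψ_m ∘ (columns of K)`,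
# `comp K Ψ̂ᵀ = Ψ_m ∘ (rows of K)` with NO hypothesis on `K`
# (β sub-cell, BINDER-OWNERS row D1; cross-lane idle seat t4-ne9-formalise-leaf-06 gen 32 on the row-D1 OWNER an2-g24's leaf list
# `HOME/b2b-balaban-beta-an2/gen24/K-U3d-LEAVES.v1.3205b2870f6492d5.md` §L2 — signatures as printed there, the row's binders `0 < L`, `hr : ∀ k, r k ∈ box (d+1) L`
# carried by the bridge; over L1 `CompositeCorrectorForms` p241443 and the kernel currency of `AxialDressingRootedBmKernel` BY NAME)

HONEST FRAMING (cell charter, verbatim): «discharging BetaPertH makes Balaban's UV stability UNCONDITIONAL — a real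
constructive-QFT result; it is NOT the continuum limit and NOT the Clay problem.»
HONEST DEPENDENCY: continuum YM on T⁴ ⇐ BetaPertH ∧ nine spine estimates (0/9 proved); BetaPertH ⇐ (D1) ∧ (D4) ∧ CAP+tail;
G-an2-4 gates asym, D1 and NE2/3/4.
ABSOLUTE RULE (cell, verbatim): «No internally-minted statement may enter as a cited fact. Every hypothesis is either kernel-proved in this
package or a verbatim quotation of a PUBLISHED theorem with page reference. The manuscript(s) under audit are NOT citable for their own
disputed steps — they are the thing under adjudication; programme-internal (2001/route/tribunal) claims are never citable.»
NOTHING below is cited: no `[cite: …]`, no `Prop` fact.  [our object] DATA definitions (`indR`, `kerOf`, `psiK`, `phiK`) and [folklore]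
finite-sum bookkeeping over the cell's OWN typed objects BY NAME: lit's `ExpKernelCalculus.MKer ∕ comp`, `HessKerSchurResolvent.idK`, `OneStepResolventKernel.Fib`,
the lead's `TameKernelCalculus.trK`, an2's `AxialDressingRooted.bondInd ∕ tsum_point`, the row-D1 owner's L1 `CompositeCorrectorForms.corrPsi ∕ corrPhi`, and this
seat's `CompositeCorrectorLinear` (`corrPsi_sum_smul ∕ corrPhi_sum_smul ∕ _zero`) and `CompositeCorrectorLocality` (`DepOn`, `CorrReads ⊆ corrDep`, `depOn_corrPsi ∕ _corrPhi`).
It asserts nothing about Bałaban's non-linear averages beyond their typed linearisations.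

WHY (row-D1 owner an2-g24, K-U3d-SCOPE v1 §0/§2; REFEREE #30 I-d1ref30-2).  The END of K-U3d (leaf L4) feeds `Ψ̂`, `Φ̂` as KERNELS of the `comp` calculus to
K-U3c `relInv_congr_kernel`; L3's identities `comp Ψ̂ Φ̂ = idK`, … are L1's Form-level corrector identities read through the APPLY BRIDGE of this file,
`(comp Ψ̂ K)_{(x,α),(z,b)} = (Ψ_m (K_{(·,·),(z,b)}))_α(x)`: the middle `tsum` of `comp` is a finite sum because `(Ψ_m A)_α(x)` reads only the finitely many
bonds of `CorrReads (L^m) α x` and is linear on finite combinations.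

WHAT (`d+1` the lattice dimension; `L` the block side, `m` levels, `n = L^m`; roots `r` in their blocks; all [folklore] unless marked):
§1 [our object] `indR β y` (the real bond indicator); `indR_apply`, `sum_smul_indR_apply`.
§2 GENERIC: `apply_eq_sum_of_depOn` (FINITE EXPANSION), `apply_indR_eq_zero_of_not_mem` (SUPPORT); [our object] `kerOf T` (the kerneliser: field block
   `(T e_{(β,y)})_α(x)`, multiplier block `idK` — an2's `piKBm` pattern WITHOUT window) with entry lemmas; THE BRIDGES `comp_kerOf_inl ∕ _inr`, `comp_trK_kerOf_inl ∕ _inr`.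
§3 [our object] **`psiK r L m := kerOf (corrPsi r L m)`**, **`phiK r L m := kerOf (corrPhi r L m)`**; entries `psiK_inl_inl` (`= corrPsi r L m (indR β y) α x`), `_inl_inr = 0`,
   `_inr_inl = 0`, `_inr_inr = [x = y ∧ μ = μ']` (+ `phiK`); EXPANSION **`corrPsi_apply_eq_sum ∕ corrPhi_apply_eq_sum`**; ROW-FINITENESS **`psiK_inl_inl_eq_zero ∕
   phiK_inl_inl_eq_zero`** off `CorrReads`; FINITE RANGE **`psiK_eq_idK_of_blk_ne ∕ phiK_eq_idK_of_blk_ne`** (range `0` in block units, one-sided; an3-g39 (R5));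
   THE APPLY BRIDGE **`comp_psiK_inl`** (`comp (psiK r L m) K x z (inl α) b = corrPsi r L m (fun κ y => K y z (inl κ) b) α x`, NO hypothesis on `K`),
   **`comp_psiK_inr`**, **`comp_trK_psiK_inl`** (`comp K (trK (psiK r L m)) x z a (inl β) = corrPsi r L m (fun κ y => K x y a (inl κ)) β z`), **`comp_trK_psiK_inr`**,
   and the four `phiK` twins.  NOT HERE (leaf list §L2, PART 2): `psiK_shift`, `spr_psiK` — after the owner's L1 v1.1 `corrPsi_shift`.
Provenance: β sub-cell; cross-lane idle seat `b2b-balaban-t4-ne9-formalise-leaf-06` gen 32 (prover-b2b-balaban-t4-ne9-formalise-leaf-06-g32-0), 2026-08-21, on the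
row-D1 owner's K-U3d leaf list (INTENT journal l.23693, SHAPE l.23754).  NOT (SDF), NOT D1, NEVER «(Z) closed» before L4 consumes `relInv_congr_kernel` BY NAME,
NOT `BetaPertH`, NOT continuum, NOT Clay.
-/

namespace Summit.QuantumFields.BalabanUV.Beta.CompositeCorrectorKernel

open Finset
open scoped BigOperators
open Literature.MathematicalPhysics.QuantumFieldTheory.Balaban1983to89
open Literature.MathematicalPhysics.QuantumFieldTheory.Balaban1983to89.Beta
open ExpKernelCalculus (MKer comp)
open HessKerSchurResolvent (idK idK_apply)
open OneStepResolventKernel (Fib)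
open AffineAveraging (Site Form1 box unitVec)
open AveragingContours (blk)
open Summit.QuantumFields.BalabanUV.Beta.TameKernelCalculus (trK)
open Summit.QuantumFields.BalabanUV.Beta.AxialDressingRooted (bondInd bondInd_apply tsum_point)
open Summit.QuantumFields.BalabanUV.Beta.CompositeCorrectorForms (corrPhi corrPsi)
open Summit.QuantumFields.BalabanUV.Beta.CompositeCorrectorLinear (corrPsi_sum_smul corrPhi_sum_smul corrPsi_zero corrPhi_zero)
open Summit.QuantumFields.BalabanUV.Beta.CompositeCorrectorLocality (DepOn CorrReads corrDep mem_corrDep_of_mem_corrReads depOn_corrPsi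
  depOn_corrPhi)

noncomputable section

variable {d : ℕ}

/-! ## §1 The real bond indicator -/

/-- [our object] The REAL indicator one-form of the bond `(β, y)`: `indR β y κ z = [κ = β ∧ z = y]` (an2's `bondInd`, cast to `ℝ`). -/
def indR (β : Fin (d + 1)) (y : Site (d + 1)) : Form1 (d + 1) ℝ := fun κ z => (bondInd β y κ z : ℝ)

/-- [folklore] Pointwise form of `indR`. -/
theorem indR_apply (β : Fin (d + 1)) (y : Site (d + 1)) (κ : Fin (d + 1)) (z : Site (d + 1)) :
    indR β y κ z = if κ = β ∧ z = y then 1 else 0 := by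
  unfold indR
  rw [bondInd_apply]
  split_ifs <;> simp

/-- [folklore] A finite linear combination of bond indicators, evaluated: `(Σ_{p ∈ S} c_p • e_p)_κ(z) = [(κ,z) ∈ S]·c_{(κ,z)}`. -/
theorem sum_smul_indR_apply (S : Finset (Fin (d + 1) × Site (d + 1))) (c : Fin (d + 1) × Site (d + 1) → ℝ) (κ : Fin (d + 1))
    (z : Site (d + 1)) : (∑ p ∈ S, c p • indR p.1 p.2) κ z = if (κ, z) ∈ S then c (κ, z) else 0 := by
  classical
  rw [Finset.sum_apply, Finset.sum_apply]
  simp only [Pi.smul_apply, smul_eq_mul, indR_apply, mul_ite, mul_one, mul_zero]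
  have h : ∀ p : Fin (d + 1) × Site (d + 1), (κ = p.1 ∧ z = p.2) ↔ (κ, z) = p := fun p => by
    constructor
    · rintro ⟨h1, h2⟩; exact Prod.ext h1 h2
    · rintro rfl; exact ⟨rfl, rfl⟩
  simp_rw [h]
  rw [Finset.sum_ite_eq]

/-! ## §2 Generic: finite expansion, support, the kerneliser and its bridges -/

/-- [folklore] **FINITE EXPANSION.**  A component functional `A ↦ (T A)_α(x)` that reads only the bonds of `P ⊆ S` (`S` finite) of an operator `T` linear on finite
combinations is the finite sum `Σ_{p ∈ S} (T e_p)_α(x) · A_p`. -/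
theorem apply_eq_sum_of_depOn {T : Form1 (d + 1) ℝ → Form1 (d + 1) ℝ} {α : Fin (d + 1)} {x : Site (d + 1)} {P : Set (Fin (d + 1) × Site (d + 1))}
    {S : Finset (Fin (d + 1) × Site (d + 1))} (hdep : DepOn P fun A => T A α x) (hPS : ∀ p ∈ P, p ∈ S)
    (hlin : ∀ (s : Finset (Fin (d + 1) × Site (d + 1))) (c : Fin (d + 1) × Site (d + 1) → ℝ) (B : Fin (d + 1) × Site (d + 1) → Form1 (d + 1) ℝ),
      T (∑ i ∈ s, c i • B i) = ∑ i ∈ s, c i • T (B i))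
    (A : Form1 (d + 1) ℝ) : T A α x = ∑ p ∈ S, T (indR p.1 p.2) α x * A p.1 p.2 := by
  have e1 : T A α x = T (∑ p ∈ S, A p.1 p.2 • indR p.1 p.2) α x := by
    apply hdep.eq
    intro κ y hp
    rw [sum_smul_indR_apply, if_pos (hPS _ hp)]
  rw [e1, hlin, Finset.sum_apply, Finset.sum_apply]
  exact Finset.sum_congr rfl fun p _ => by rw [Pi.smul_apply, Pi.smul_apply, smul_eq_mul, mul_comm]

/-- [folklore] **SUPPORT.**  If `A ↦ (T A)_α(x)` reads only the bonds of `P` and `T 0 = 0`, then `(T e_{(κ,y)})_α(x) = 0` for every bond `(κ, y) ∉ P`. -/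
theorem apply_indR_eq_zero_of_not_mem {T : Form1 (d + 1) ℝ → Form1 (d + 1) ℝ} {α : Fin (d + 1)} {x : Site (d + 1)}
    {P : Set (Fin (d + 1) × Site (d + 1))} (hdep : DepOn P fun A => T A α x) (hzero : T 0 = 0) {κ : Fin (d + 1)} {y : Site (d + 1)}
    (h : (κ, y) ∉ P) : T (indR κ y) α x = 0 := by
  have e : T (indR κ y) α x = T 0 α x := by
    apply hdep.eq
    intro κ' y' hp
    rw [indR_apply, if_neg]
    · rfl
    · rintro ⟨rfl, rfl⟩
      exact h hp
  rw [e, hzero]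
  rfl

/-- [our object] THE KERNELISER of a field operator `T`: field block `(T e_{(β,y)})_α(x)` (row `(x,α)`, column `(y,β)`), off-diagonal blocks `0`, multiplier block
the identity — the pattern of an2's `AxialDressingRootedBmKernel.piKBm` WITHOUT a window cut-off (exact identities must survive). -/
def kerOf (T : Form1 (d + 1) ℝ → Form1 (d + 1) ℝ) : MKer (d + 1) (Fib d) :=
  fun x y a b =>
    match a, b with
    | Sum.inl α, Sum.inl β => T (indR β y) α x
    | Sum.inl _, Sum.inr _ => 0
    | Sum.inr _, Sum.inl _ => 0
    | Sum.inr μ, Sum.inr μ' => if x = y ∧ μ = μ' then 1 else 0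

/-- [folklore] Field–field entry of the kerneliser. -/
theorem kerOf_inl_inl (T : Form1 (d + 1) ℝ → Form1 (d + 1) ℝ) (x y : Site (d + 1)) (α β : Fin (d + 1)) :
    kerOf T x y (Sum.inl α) (Sum.inl β) = T (indR β y) α x := rfl

/-- [folklore] Field–multiplier entry vanishes. -/
theorem kerOf_inl_inr (T : Form1 (d + 1) ℝ → Form1 (d + 1) ℝ) (x y : Site (d + 1)) (α μ : Fin (d + 1)) :
    kerOf T x y (Sum.inl α) (Sum.inr μ) = 0 := rfl

/-- [folklore] Multiplier–field entry vanishes. -/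
theorem kerOf_inr_inl (T : Form1 (d + 1) ℝ → Form1 (d + 1) ℝ) (x y : Site (d + 1)) (μ α : Fin (d + 1)) :
    kerOf T x y (Sum.inr μ) (Sum.inl α) = 0 := rfl

/-- [folklore] Multiplier–multiplier entry is the identity. -/
theorem kerOf_inr_inr (T : Form1 (d + 1) ℝ → Form1 (d + 1) ℝ) (x y : Site (d + 1)) (μ μ' : Fin (d + 1)) :
    kerOf T x y (Sum.inr μ) (Sum.inr μ') = if x = y ∧ μ = μ' then 1 else 0 := rfl

/-- [folklore] **THE APPLY BRIDGE, LEFT ACTION ON COLUMNS** (generic): for `T` linear on finite combinations whose components read finite sets,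
`(comp (kerOf T) K)_{(x, inl α),(z,b)} = (T (κ, y ↦ K_{(y, inl κ),(z,b)}))_α(x)` — NO hypothesis on `K` (the middle `tsum` is a finite sum). -/
theorem comp_kerOf_inl {T : Form1 (d + 1) ℝ → Form1 (d + 1) ℝ} {P : Fin (d + 1) → Site (d + 1) → Set (Fin (d + 1) × Site (d + 1))}
    (hdep : ∀ α x, DepOn (P α x) fun A => T A α x)
    (hlin : ∀ (s : Finset (Fin (d + 1) × Site (d + 1))) (c : Fin (d + 1) × Site (d + 1) → ℝ) (B : Fin (d + 1) × Site (d + 1) → Form1 (d + 1) ℝ),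
      T (∑ i ∈ s, c i • B i) = ∑ i ∈ s, c i • T (B i))
    (hfin : ∀ α x, ∃ S : Finset (Fin (d + 1) × Site (d + 1)), ∀ p ∈ P α x, p ∈ S)
    (K : MKer (d + 1) (Fib d)) (x z : Site (d + 1)) (α : Fin (d + 1)) (b : Fib d) :
    comp (kerOf T) K x z (Sum.inl α) b = T (fun κ y => K y z (Sum.inl κ) b) α x := by
  classical
  obtain ⟨S, hS⟩ := hfin α x
  have hT0 : T 0 = 0 := by simpa using hlin ∅ (fun _ => 0) fun _ => 0
  unfold ExpKernelCalculus.comp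
  have hf : ∀ y, ∑ f : Fib d, kerOf T x y (Sum.inl α) f * K y z f b
      = ∑ κ : Fin (d + 1), T (indR κ y) α x * K y z (Sum.inl κ) b := by
    intro y
    rw [Fintype.sum_sum_type]
    simp only [kerOf_inl_inl, kerOf_inl_inr, zero_mul, Finset.sum_const_zero, add_zero]
  simp_rw [hf]
  have hS' : ∀ p ∈ P α x, p ∈ Finset.univ ×ˢ S.image Prod.snd := fun p hp =>
    Finset.mem_product.2 ⟨Finset.mem_univ _, Finset.mem_image_of_mem _ (hS p hp)⟩
  rw [tsum_eq_sum (s := S.image Prod.snd)]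
  · rw [apply_eq_sum_of_depOn (hdep α x) hS' hlin, Finset.sum_product_right]
  · intro y hy
    refine Finset.sum_eq_zero fun κ _ => ?_
    rw [apply_indR_eq_zero_of_not_mem (hdep α x) hT0 (fun hp => hy (Finset.mem_image_of_mem _ (hS _ hp))), zero_mul]

/-- [folklore] **LEFT ACTION, MULTIPLIER ROWS ARE UNTOUCHED** (generic): `(comp (kerOf T) K)_{(x, inr μ),(z,b)} = K_{(x, inr μ),(z,b)}`. -/
theorem comp_kerOf_inr (T : Form1 (d + 1) ℝ → Form1 (d + 1) ℝ) (K : MKer (d + 1) (Fib d)) (x z : Site (d + 1)) (μ : Fin (d + 1)) (b : Fib d) :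
    comp (kerOf T) K x z (Sum.inr μ) b = K x z (Sum.inr μ) b := by
  classical
  unfold ExpKernelCalculus.comp
  have h : ∀ y, ∑ f : Fib d, kerOf T x y (Sum.inr μ) f * K y z f b = if x = y then K y z (Sum.inr μ) b else 0 := by
    intro y
    rw [Fintype.sum_sum_type]
    simp only [kerOf_inr_inl, kerOf_inr_inr, zero_mul, Finset.sum_const_zero, zero_add]
    by_cases hy : x = y
    · simp only [hy, true_and, ite_mul, one_mul, zero_mul, Finset.sum_ite_eq, Finset.mem_univ, if_true]
    · simp [hy]
  simp_rw [h]
  exact tsum_point x _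

/-- [folklore] **THE APPLY BRIDGE, RIGHT ACTION ON ROWS** (generic): `(comp K (trK (kerOf T)))_{(x,a),(z, inl β)} = (T (κ, y ↦ K_{(x,a),(y, inl κ)}))_β(z)` — NO
hypothesis on `K`. -/
theorem comp_trK_kerOf_inl {T : Form1 (d + 1) ℝ → Form1 (d + 1) ℝ} {P : Fin (d + 1) → Site (d + 1) → Set (Fin (d + 1) × Site (d + 1))}
    (hdep : ∀ α x, DepOn (P α x) fun A => T A α x)
    (hlin : ∀ (s : Finset (Fin (d + 1) × Site (d + 1))) (c : Fin (d + 1) × Site (d + 1) → ℝ) (B : Fin (d + 1) × Site (d + 1) → Form1 (d + 1) ℝ),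
      T (∑ i ∈ s, c i • B i) = ∑ i ∈ s, c i • T (B i))
    (hfin : ∀ α x, ∃ S : Finset (Fin (d + 1) × Site (d + 1)), ∀ p ∈ P α x, p ∈ S)
    (K : MKer (d + 1) (Fib d)) (x z : Site (d + 1)) (a : Fib d) (β : Fin (d + 1)) :
    comp K (trK (kerOf T)) x z a (Sum.inl β) = T (fun κ y => K x y a (Sum.inl κ)) β z := by
  classical
  obtain ⟨S, hS⟩ := hfin β z
  have hT0 : T 0 = 0 := by simpa using hlin ∅ (fun _ => 0) fun _ => 0
  unfold ExpKernelCalculus.comp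
  have hf : ∀ y, ∑ f : Fib d, K x y a f * trK (kerOf T) y z f (Sum.inl β)
      = ∑ κ : Fin (d + 1), T (indR κ y) β z * K x y a (Sum.inl κ) := by
    intro y
    rw [Fintype.sum_sum_type]
    simp only [trK, kerOf_inl_inl, kerOf_inl_inr, mul_zero, Finset.sum_const_zero, add_zero]
    exact Finset.sum_congr rfl fun κ _ => mul_comm _ _
  simp_rw [hf]
  have hS' : ∀ p ∈ P β z, p ∈ Finset.univ ×ˢ S.image Prod.snd := fun p hp =>
    Finset.mem_product.2 ⟨Finset.mem_univ _, Finset.mem_image_of_mem _ (hS p hp)⟩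
  rw [tsum_eq_sum (s := S.image Prod.snd)]
  · rw [apply_eq_sum_of_depOn (hdep β z) hS' hlin, Finset.sum_product_right]
  · intro y hy
    refine Finset.sum_eq_zero fun κ _ => ?_
    rw [apply_indR_eq_zero_of_not_mem (hdep β z) hT0 (fun hp => hy (Finset.mem_image_of_mem _ (hS _ hp))), zero_mul]

/-- [folklore] **RIGHT ACTION, MULTIPLIER COLUMNS ARE UNTOUCHED** (generic): `(comp K (trK (kerOf T)))_{(x,a),(z, inr μ)} = K_{(x,a),(z, inr μ)}`. -/
theorem comp_trK_kerOf_inr (T : Form1 (d + 1) ℝ → Form1 (d + 1) ℝ) (K : MKer (d + 1) (Fib d)) (x z : Site (d + 1)) (a : Fib d)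
    (μ : Fin (d + 1)) : comp K (trK (kerOf T)) x z a (Sum.inr μ) = K x z a (Sum.inr μ) := by
  classical
  unfold ExpKernelCalculus.comp
  have h : ∀ y, ∑ f : Fib d, K x y a f * trK (kerOf T) y z f (Sum.inr μ) = if z = y then K x y a (Sum.inr μ) else 0 := by
    intro y
    rw [Fintype.sum_sum_type]
    simp only [trK, kerOf_inr_inl, kerOf_inr_inr, mul_zero, Finset.sum_const_zero, zero_add]
    by_cases hy : z = y
    · simp only [hy, true_and, mul_ite, mul_one, mul_zero, Finset.sum_ite_eq, Finset.mem_univ, if_true]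
    · simp [hy]
  simp_rw [h]
  exact tsum_point z _

/-! ## §3 The kernelised correctors `Ψ̂ = psiK`, `Φ̂ = phiK` -/

/-- [our object] **THE KERNELISED CORRECTOR `Ψ̂`**: `psiK r L m x y (inl α) (inl β) = (Ψ_m e_{(β,y)})_α(x)`, `fm = mf = 0`, `mm = [x = y ∧ μ = μ']`. -/
def psiK (r : ℕ → (Fin (d + 1) → ℕ)) (L m : ℕ) : MKer (d + 1) (Fib d) := kerOf (corrPsi r L m)

/-- [our object] **THE KERNELISED INVERSE CORRECTOR `Φ̂`**: the same with `Φ_m`. -/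
def phiK (r : ℕ → (Fin (d + 1) → ℕ)) (L m : ℕ) : MKer (d + 1) (Fib d) := kerOf (corrPhi r L m)

section Entries

variable (r : ℕ → (Fin (d + 1) → ℕ)) (L m : ℕ) (x y : Site (d + 1))

/-- [folklore] `psiK` field–field entry: `(Ψ_m e_{(β,y)})_α(x)`. -/
theorem psiK_inl_inl (α β : Fin (d + 1)) : psiK r L m x y (Sum.inl α) (Sum.inl β) = corrPsi r L m (indR β y) α x := rfl
/-- [folklore] `psiK` field–multiplier entry vanishes. -/
theorem psiK_inl_inr (α μ : Fin (d + 1)) : psiK r L m x y (Sum.inl α) (Sum.inr μ) = 0 := rfl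
/-- [folklore] `psiK` multiplier–field entry vanishes. -/
theorem psiK_inr_inl (μ α : Fin (d + 1)) : psiK r L m x y (Sum.inr μ) (Sum.inl α) = 0 := rfl
/-- [folklore] `psiK` multiplier–multiplier entry is the identity. -/
theorem psiK_inr_inr (μ μ' : Fin (d + 1)) : psiK r L m x y (Sum.inr μ) (Sum.inr μ') = if x = y ∧ μ = μ' then 1 else 0 := rfl
/-- [folklore] `phiK` field–field entry: `(Φ_m e_{(β,y)})_α(x)`. -/
theorem phiK_inl_inl (α β : Fin (d + 1)) : phiK r L m x y (Sum.inl α) (Sum.inl β) = corrPhi r L m (indR β y) α x := rfl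
/-- [folklore] `phiK` field–multiplier entry vanishes. -/
theorem phiK_inl_inr (α μ : Fin (d + 1)) : phiK r L m x y (Sum.inl α) (Sum.inr μ) = 0 := rfl
/-- [folklore] `phiK` multiplier–field entry vanishes. -/
theorem phiK_inr_inl (μ α : Fin (d + 1)) : phiK r L m x y (Sum.inr μ) (Sum.inl α) = 0 := rfl
/-- [folklore] `phiK` multiplier–multiplier entry is the identity. -/
theorem phiK_inr_inr (μ μ' : Fin (d + 1)) : phiK r L m x y (Sum.inr μ) (Sum.inr μ') = if x = y ∧ μ = μ' then 1 else 0 := rfl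

end Entries

section Bridge

variable {L : ℕ} (hL : 0 < L) {r : ℕ → (Fin (d + 1) → ℕ)} (hr : ∀ k, r k ∈ box (d + 1) L) (m : ℕ)
include hL hr

omit hr in
/-- [folklore] The read set of a corrector component is contained in the `Finset` `corrDep`. -/
theorem exists_finset_corrReads (α : Fin (d + 1)) (x : Site (d + 1)) :
    ∃ S : Finset (Fin (d + 1) × Site (d + 1)), ∀ p ∈ CorrReads (L ^ m) α x, p ∈ S :=
  ⟨corrDep (L ^ m) α x, fun _ hp => mem_corrDep_of_mem_corrReads (pow_pos hL m) hp⟩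

/-- [folklore] **FINITE EXPANSION OF `Ψ_m`**: `(Ψ_m A)_α(x) = Σ_{p ∈ S} (Ψ_m e_p)_α(x) · A_p` for every `Finset` `S ⊇ CorrReads (L^m) α x` (e.g. `corrDep`). -/
theorem corrPsi_apply_eq_sum (α : Fin (d + 1)) (x : Site (d + 1)) {S : Finset (Fin (d + 1) × Site (d + 1))}
    (hS : ∀ p ∈ CorrReads (L ^ m) α x, p ∈ S) (A : Form1 (d + 1) ℝ) :
    corrPsi r L m A α x = ∑ p ∈ S, corrPsi r L m (indR p.1 p.2) α x * A p.1 p.2 :=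
  apply_eq_sum_of_depOn (depOn_corrPsi hL r hr m α x) hS (corrPsi_sum_smul r L m) A

/-- [folklore] **FINITE EXPANSION OF `Φ_m`**. -/
theorem corrPhi_apply_eq_sum (α : Fin (d + 1)) (x : Site (d + 1)) {S : Finset (Fin (d + 1) × Site (d + 1))}
    (hS : ∀ p ∈ CorrReads (L ^ m) α x, p ∈ S) (A : Form1 (d + 1) ℝ) :
    corrPhi r L m A α x = ∑ p ∈ S, corrPhi r L m (indR p.1 p.2) α x * A p.1 p.2 :=
  apply_eq_sum_of_depOn (depOn_corrPhi hL r hr m α x) hS (corrPhi_sum_smul r L m) A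

/-- [folklore] **ROW-FINITENESS OF `Ψ̂`**: the field–field entry vanishes off the read set. -/
theorem psiK_inl_inl_eq_zero {x y : Site (d + 1)} {α β : Fin (d + 1)} (h : (β, y) ∉ CorrReads (L ^ m) α x) :
    psiK r L m x y (Sum.inl α) (Sum.inl β) = 0 :=
  apply_indR_eq_zero_of_not_mem (depOn_corrPsi hL r hr m α x) (corrPsi_zero r L m) h

/-- [folklore] **ROW-FINITENESS OF `Φ̂`**. -/
theorem phiK_inl_inl_eq_zero {x y : Site (d + 1)} {α β : Fin (d + 1)} (h : (β, y) ∉ CorrReads (L ^ m) α x) :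
    phiK r L m x y (Sum.inl α) (Sum.inl β) = 0 :=
  apply_indR_eq_zero_of_not_mem (depOn_corrPhi hL r hr m α x) (corrPhi_zero r L m) h

/-- [folklore] **FINITE RANGE `0` IN BLOCK UNITS** (one-sided; an3-g39 (R5)): if the `n`-block of `y` is neither the block of `x` nor the block of any `x + e_α`, then
`Ψ̂_{(x,·),(y,·)} = idK_{(x,·),(y,·)}` (`n = L^m`). -/
theorem psiK_eq_idK_of_blk_ne {x y : Site (d + 1)} (h1 : blk (L ^ m) y ≠ blk (L ^ m) x)
    (h2 : ∀ α : Fin (d + 1), blk (L ^ m) y ≠ blk (L ^ m) (x + unitVec α)) (a b : Fib d) :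
    psiK r L m x y a b = idK x y a b := by
  classical
  have hxy : x ≠ y := fun e => h1 (by rw [e])
  rcases a with α | μ <;> rcases b with β | μ'
  · rw [idK_apply, if_neg (fun h => hxy h.1)]
    refine psiK_inl_inl_eq_zero hL hr m fun hp => ?_
    rcases hp with hp | hp | hp
    · exact hxy (Prod.ext_iff.1 hp).2.symm
    · exact h1 hp.1
    · exact h2 α hp.1
  · rw [psiK_inl_inr, idK_apply, if_neg (fun h => hxy h.1)]
  · rw [psiK_inr_inl, idK_apply, if_neg (fun h => hxy h.1)]
  · rw [psiK_inr_inr, idK_apply]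
    by_cases h : x = y ∧ μ = μ'
    · rw [if_pos h, if_pos ⟨h.1, congrArg Sum.inr h.2⟩]
    · rw [if_neg h, if_neg (fun h' => h ⟨h'.1, Sum.inr_injective h'.2⟩)]

/-- [folklore] **FINITE RANGE `0` IN BLOCK UNITS FOR `Φ̂`.** -/
theorem phiK_eq_idK_of_blk_ne {x y : Site (d + 1)} (h1 : blk (L ^ m) y ≠ blk (L ^ m) x)
    (h2 : ∀ α : Fin (d + 1), blk (L ^ m) y ≠ blk (L ^ m) (x + unitVec α)) (a b : Fib d) :
    phiK r L m x y a b = idK x y a b := by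
  classical
  have hxy : x ≠ y := fun e => h1 (by rw [e])
  rcases a with α | μ <;> rcases b with β | μ'
  · rw [idK_apply, if_neg (fun h => hxy h.1)]
    refine phiK_inl_inl_eq_zero hL hr m fun hp => ?_
    rcases hp with hp | hp | hp
    · exact hxy (Prod.ext_iff.1 hp).2.symm
    · exact h1 hp.1
    · exact h2 α hp.1
  · rw [phiK_inl_inr, idK_apply, if_neg (fun h => hxy h.1)]
  · rw [phiK_inr_inl, idK_apply, if_neg (fun h => hxy h.1)]
  · rw [phiK_inr_inr, idK_apply]
    by_cases h : x = y ∧ μ = μ'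
    · rw [if_pos h, if_pos ⟨h.1, congrArg Sum.inr h.2⟩]
    · rw [if_neg h, if_neg (fun h' => h ⟨h'.1, Sum.inr_injective h'.2⟩)]

/-- [folklore] **THE APPLY BRIDGE FOR `Ψ̂`, LEFT ACTION ON COLUMNS** — NO hypothesis on `K`:
`comp (psiK r L m) K x z (inl α) b = (Ψ_m (κ, y ↦ K y z (inl κ) b))_α(x)`. -/
theorem comp_psiK_inl (K : MKer (d + 1) (Fib d)) (x z : Site (d + 1)) (α : Fin (d + 1)) (b : Fib d) :
    comp (psiK r L m) K x z (Sum.inl α) b = corrPsi r L m (fun κ y => K y z (Sum.inl κ) b) α x :=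
  comp_kerOf_inl (depOn_corrPsi hL r hr m) (corrPsi_sum_smul r L m) (exists_finset_corrReads hL m) K x z α b

omit hL hr in
/-- [folklore] `comp (psiK r L m) K x z (inr μ) b = K x z (inr μ) b`. -/
theorem comp_psiK_inr (K : MKer (d + 1) (Fib d)) (x z : Site (d + 1)) (μ : Fin (d + 1)) (b : Fib d) :
    comp (psiK r L m) K x z (Sum.inr μ) b = K x z (Sum.inr μ) b :=
  comp_kerOf_inr _ K x z μ b

/-- [folklore] **THE APPLY BRIDGE FOR `Ψ̂`, RIGHT ACTION ON ROWS** — NO hypothesis on `K`: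
`comp K (trK (psiK r L m)) x z a (inl β) = (Ψ_m (κ, y ↦ K x y a (inl κ)))_β(z)`. -/
theorem comp_trK_psiK_inl (K : MKer (d + 1) (Fib d)) (x z : Site (d + 1)) (a : Fib d) (β : Fin (d + 1)) :
    comp K (trK (psiK r L m)) x z a (Sum.inl β) = corrPsi r L m (fun κ y => K x y a (Sum.inl κ)) β z :=
  comp_trK_kerOf_inl (depOn_corrPsi hL r hr m) (corrPsi_sum_smul r L m) (exists_finset_corrReads hL m) K x z a β

omit hL hr in
/-- [folklore] `comp K (trK (psiK r L m)) x z a (inr μ) = K x z a (inr μ)`. -/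
theorem comp_trK_psiK_inr (K : MKer (d + 1) (Fib d)) (x z : Site (d + 1)) (a : Fib d) (μ : Fin (d + 1)) :
    comp K (trK (psiK r L m)) x z a (Sum.inr μ) = K x z a (Sum.inr μ) :=
  comp_trK_kerOf_inr _ K x z a μ

/-- [folklore] **THE APPLY BRIDGE FOR `Φ̂`, LEFT ACTION ON COLUMNS** — NO hypothesis on `K`. -/
theorem comp_phiK_inl (K : MKer (d + 1) (Fib d)) (x z : Site (d + 1)) (α : Fin (d + 1)) (b : Fib d) :
    comp (phiK r L m) K x z (Sum.inl α) b = corrPhi r L m (fun κ y => K y z (Sum.inl κ) b) α x :=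
  comp_kerOf_inl (depOn_corrPhi hL r hr m) (corrPhi_sum_smul r L m) (exists_finset_corrReads hL m) K x z α b

omit hL hr in
/-- [folklore] `comp (phiK r L m) K x z (inr μ) b = K x z (inr μ) b`. -/
theorem comp_phiK_inr (K : MKer (d + 1) (Fib d)) (x z : Site (d + 1)) (μ : Fin (d + 1)) (b : Fib d) :
    comp (phiK r L m) K x z (Sum.inr μ) b = K x z (Sum.inr μ) b :=
  comp_kerOf_inr _ K x z μ b

/-- [folklore] **THE APPLY BRIDGE FOR `Φ̂`, RIGHT ACTION ON ROWS** — NO hypothesis on `K`. -/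
theorem comp_trK_phiK_inl (K : MKer (d + 1) (Fib d)) (x z : Site (d + 1)) (a : Fib d) (β : Fin (d + 1)) :
    comp K (trK (phiK r L m)) x z a (Sum.inl β) = corrPhi r L m (fun κ y => K x y a (Sum.inl κ)) β z :=
  comp_trK_kerOf_inl (depOn_corrPhi hL r hr m) (corrPhi_sum_smul r L m) (exists_finset_corrReads hL m) K x z a β

omit hL hr in
/-- [folklore] `comp K (trK (phiK r L m)) x z a (inr μ) = K x z a (inr μ)`. -/
theorem comp_trK_phiK_inr (K : MKer (d + 1) (Fib d)) (x z : Site (d + 1)) (a : Fib d) (μ : Fin (d + 1)) :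
    comp K (trK (phiK r L m)) x z a (Sum.inr μ) = K x z a (Sum.inr μ) :=
  comp_trK_kerOf_inr _ K x z a μ

end Bridge

end

end Summit.QuantumFields.BalabanUV.Beta.CompositeCorrectorKernel
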